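import Summits.Parity.BatemanHorn.Theorems.SoloInformedThinTypeII
import Mathlib.Analysis.SpecialFunctions.Pow.Asymptotics
import HarnessLib

/-!
# Thin sequences vs. Type-I/II information, III: no Type-II window for a thin support

Part of the `SoloInformedThin*` series (`…Counting`, `…TypeII`, `…TypeIIVoid`, `…TypeI`,
`…Polynomial`), which turns Ford–Maynard's heuristic remark (arXiv:2407.14368, §2.4: for the
normalised indicator of a set `𝒥 ⊆ (x/2, x]` with `x^{1-c}` elements "one can only hope for (I)
to hold for `γ < 1 − c` and (II) for `θ > c`") into theorems about EVERY real sequence with thin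
support, in the tree's exact formalisation `Literature.Barriers.Parity.FordMaynard.TypeI` /
`TypeII` (comparison sequence `b = 1`, `w = a − 1`).  The tree's barrier entry
`Literature.Barriers.Parity.FordMaynardLowLevel` flags the remark as "a HEURISTIC remark of the
paper, not a theorem about any specific thin set"; these files supply the theorem.

This file: the asymptotic form of the Type-II half.  For `B > 1` and all large `x`, NO real
sequence `a` with at most `x^{1−c}` non-zero values on `(x/2, x]` has `w = a − 1` satisfying (II)
in a range `[θ, θ + ν]` with
* `θ < c` (`eventually_not_typeII_of_sparse`; primes `p ∈ (M, 2M]`, `M ≍ (x/2)^θ`, on the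
  `m`-side), or
* `θ + ν > 1 − c` (`eventually_not_typeII_of_sparse'`; primes `p ≍ x^{max(1−θ−ν, 0)}` on the
  `n`-side).
In particular a support of size `≤ x^{1/2}` admits no Type-II window whatsoever (every window has
`θ < 1/2` or `θ + ν > θ ≥ 1/2`); see `SoloInformedThinPolynomial`.

References: [cite: FordMaynard2024PrimeSieves, §2.4 (p. 7, first family and footnote)].
-/

noncomputable section

open Filter Finset Real

namespace Summit.Parity.BatemanHorn.Theorems

open Literature.Barriers.Parity.FordMaynard (TypeII eventually_mul_rpow_le_rpow)

/-! ### Asymptotic forms: thin supports -/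

/-- **No Type-II information below the density exponent.**  Let `0 ≤ θ < c ≤ 1`, `ν > 0`,
`B > 1`.  For all large `x`: no real sequence `a` with at most `x^{1−c}` non-zero values on
`(x/2, x]` has `w = a − 1` satisfying (II) in the range `[θ, θ + ν]`.
[cite: FordMaynard2024PrimeSieves, §2.4] -/
theorem eventually_not_typeII_of_sparse {c θ ν B : ℝ} (hθ : 0 ≤ θ) (hθc : θ < c) (hc1 : c ≤ 1)
    (hν : 0 < ν) (hB : 1 < B) :
    ∀ᶠ x : ℝ in atTop, ∀ (a : ℕ → ℝ) (A : Finset ℕ), (A.card : ℝ) ≤ x ^ (1 - c) →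
      (∀ v : ℕ, x / 2 < (v : ℝ) → (v : ℝ) ≤ x → a v ≠ 0 → v ∈ A) →
      ¬ TypeII (fun n : ℕ => a n - 1) x θ ν B := by
  obtain ⟨K, hK1, hK⟩ := exists_card_primes_Ioc_two_mul_ge
  have hK0 : 0 < K := by linarith
  have hδ : 0 < (c - θ) / 2 := by linarith
  filter_upwards [eventually_ge_atTop (4 : ℝ),
    eventually_mul_rpow_le_rpow 6 (by linarith : θ < θ + ν),
    eventually_mul_rpow_le_rpow 48 (by linarith : θ < 1),
    eventually_mul_rpow_le_rpow 96 (by linarith : θ + (1 - c) + (c - θ) / 2 < 1),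
    (isLittleO_log_rpow_atTop hδ).bound one_pos,
    ((tendsto_rpow_atTop (by linarith : 0 < B - 1)).comp
      Real.tendsto_log_atTop).eventually_gt_atTop (8 * K)]
    with x hx4 e1 e2 e3 elog e4 a A hA hcov hII
  rw [Real.rpow_one] at e2 e3
  have hx0 : 0 < x := by linarith
  have hx1 : 1 ≤ x := by linarith
  have hlx : 0 ≤ Real.log x := Real.log_nonneg hx1
  have hlogle : Real.log x ≤ x ^ ((c - θ) / 2) := by
    have := elog
    simp only [one_mul, Real.norm_eq_abs] at this
    rwa [abs_of_nonneg hlx, abs_of_nonneg (Real.rpow_nonneg hx0.le _)] at this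
  have e4' : 8 * K < Real.log x ^ (B - 1) := by simpa using e4
  -- the scale `M` and the primes `S`
  set M : ℕ := ⌊(x / 2) ^ θ⌋₊ + 2 with hMdef
  have hM2 : 2 ≤ M := by omega
  have hM2r : (2 : ℝ) ≤ M := by exact_mod_cast hM2
  have hMθ : (x / 2) ^ θ < M := by
    have := Nat.lt_floor_add_one ((x / 2) ^ θ)
    push_cast [hMdef]
    linarith
  have hxθ1 : 1 ≤ x ^ θ := Real.one_le_rpow hx1 hθ
  have hMle : (M : ℝ) ≤ 3 * x ^ θ := by
    have h1 : (⌊(x / 2) ^ θ⌋₊ : ℝ) ≤ (x / 2) ^ θ :=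
      Nat.floor_le (Real.rpow_nonneg (by linarith) _)
    have h2 : (x / 2) ^ θ ≤ x ^ θ := Real.rpow_le_rpow (by linarith) (by linarith) hθ
    push_cast [hMdef]
    linarith
  set S : Finset ℕ := (Ioc M (2 * M)).filter Nat.Prime with hSdef
  have hSprop : ∀ p ∈ S, p.Prime ∧ (M : ℝ) < p ∧ (x / 2) ^ θ < (p : ℝ) ∧
      (p : ℝ) ≤ x ^ (θ + ν) := by
    intro p hp
    rw [hSdef, mem_filter, mem_Ioc] at hp
    obtain ⟨⟨hMp, hp2M⟩, hpr⟩ := hp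
    have hMp' : (M : ℝ) < p := by exact_mod_cast hMp
    have hp2M' : (p : ℝ) ≤ 2 * M := by exact_mod_cast hp2M
    exact ⟨hpr, hMp', hMθ.trans hMp', by linarith⟩
  have hmain := typeII_sparse_le (by linarith) hx1 (by linarith : (1 : ℝ) < M) S A hSprop hcov hII
  -- lower bounds
  have hL : Real.log x / Real.log M ≤ 2 * Real.log x := by
    have hlogM : Real.log 2 ≤ Real.log M := Real.log_le_log two_pos hM2r
    have hl2 := Real.log_two_gt_d9
    rw [div_le_iff₀ (by linarith)]
    nlinarith
  have hcardS := hK M (by omega)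
  have hsum : (S.card : ℝ) * (x / (4 * M) - 1) ≤ ∑ p ∈ S, (x / (2 * p) - 1) := by
    rw [← nsmul_eq_mul, ← sum_const]
    refine sum_le_sum fun p hp => ?_
    have hp2M : (p : ℝ) ≤ 2 * M := by
      have := hp; rw [hSdef, mem_filter, mem_Ioc] at this; exact_mod_cast this.1.2
    have hp0 : (0 : ℝ) < p := by exact_mod_cast (hSprop p hp).1.pos
    have : x / (4 * M) ≤ x / (2 * p) :=
      div_le_div_of_nonneg_left hx0.le (by positivity) (by linarith)
    linarith
  have hX : (S.card : ℝ) * (A.card * (Real.log x / Real.log M)) ≤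
      S.card * (x ^ (1 - c) * (2 * Real.log x)) := by
    apply mul_le_mul_of_nonneg_left _ (Nat.cast_nonneg _)
    exact mul_le_mul hA hL (div_nonneg hlx (Real.log_nonneg (by linarith)))
      (Real.rpow_nonneg hx0.le _)
  have h8M : 8 * (M : ℝ) * (1 + 2 * x ^ (1 - c) * Real.log x) ≤ x := by
    have t1 : 8 * (M : ℝ) ≤ x / 2 := by linarith
    have hnn1 : 0 ≤ x ^ (1 - c) := Real.rpow_nonneg hx0.le _
    have hprod : x ^ θ * x ^ (1 - c) * x ^ ((c - θ) / 2) =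
        x ^ (θ + (1 - c) + (c - θ) / 2) := by
      rw [← Real.rpow_add hx0, ← Real.rpow_add hx0]
    have t2a : (M : ℝ) * x ^ (1 - c) * Real.log x ≤
        3 * x ^ θ * x ^ (1 - c) * x ^ ((c - θ) / 2) := by
      have := mul_le_mul hMle (mul_le_mul_of_nonneg_left hlogle hnn1) (by positivity)
        (by positivity)
      linarith [this, mul_assoc (M : ℝ) (x ^ (1 - c)) (Real.log x),
        mul_assoc (3 * x ^ θ) (x ^ (1 - c)) (x ^ ((c - θ) / 2))]
    rw [← hprod] at e3
    have t2 : 16 * (M : ℝ) * x ^ (1 - c) * Real.log x ≤ x / 2 := by linarith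
    have : 8 * (M : ℝ) * (1 + 2 * x ^ (1 - c) * Real.log x) =
        8 * M + 16 * M * x ^ (1 - c) * Real.log x := by ring
    linarith
  have h2Mx : 2 * (M : ℝ) ≤ x := by linarith
  have hlog2M0 : 0 < Real.log (2 * M) := Real.log_pos (by linarith)
  have hlog2M : Real.log (2 * M) ≤ Real.log x := Real.log_le_log (by positivity) h2Mx
  have hlx0 : 0 < Real.log x := by linarith
  have hTlow : x / (8 * K * Real.log x) ≤ (S.card : ℝ) * (x / (8 * M)) := by
    have hMK : (M : ℝ) / (K * Real.log x) ≤ S.card :=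
      le_trans (div_le_div_of_nonneg_left (by positivity) (mul_pos hK0 hlog2M0)
        (mul_le_mul_of_nonneg_left hlog2M hK0.le)) hcardS
    have hMne : (M : ℝ) ≠ 0 := by positivity
    have hlxne : Real.log x ≠ 0 := hlx0.ne'
    have hKne : K ≠ 0 := hK0.ne'
    calc x / (8 * K * Real.log x) = (M : ℝ) / (K * Real.log x) * (x / (8 * M)) := by
          field_simp
      _ ≤ S.card * (x / (8 * M)) := mul_le_mul_of_nonneg_right hMK (by positivity)
  have hmid : (S.card : ℝ) * (x / (8 * M)) ≤
      S.card * (x / (4 * M) - 1 - x ^ (1 - c) * (2 * Real.log x)) := by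
    apply mul_le_mul_of_nonneg_left _ (Nat.cast_nonneg _)
    have hM8 : (0 : ℝ) < 8 * M := by positivity
    have h81 : 1 + 2 * x ^ (1 - c) * Real.log x ≤ x / (8 * M) := by
      rw [le_div_iff₀ hM8]; linarith
    have hMne : (M : ℝ) ≠ 0 := by positivity
    have h84 : x / (4 * M) = 2 * (x / (8 * M)) := by
      field_simp; ring
    linarith
  have hfin := div_log_rpow_lt hK0 (by linarith) e4'
  linarith

/-- **No Type-II information above the co-density exponent (reflected window).**  Let
`0 ≤ θ < 1`, `ν > 0`, `0 < c`, `θ + ν > 1 − c`, `B > 1`.  For all large `x`: no real sequence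
with at most `x^{1−c}` non-zero values on `(x/2, x]` has `w = a − 1` satisfying (II) in the range
`[θ, θ + ν]`. [cite: FordMaynard2024PrimeSieves, §2.4] -/
theorem eventually_not_typeII_of_sparse' {c θ ν B : ℝ} (hθ : 0 ≤ θ) (hθ1 : θ < 1) (hν : 0 < ν)
    (hc : 0 < c) (hcw : 1 - c < θ + ν) (hB : 1 < B) :
    ∀ᶠ x : ℝ in atTop, ∀ (a : ℕ → ℝ) (A : Finset ℕ), (A.card : ℝ) ≤ x ^ (1 - c) →
      (∀ v : ℕ, x / 2 < (v : ℝ) → (v : ℝ) ≤ x → a v ≠ 0 → v ∈ A) →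
      ¬ TypeII (fun n : ℕ => a n - 1) x θ ν B := by
  obtain ⟨K, hK1, hK⟩ := exists_card_primes_Ioc_two_mul_ge
  have hK0 : 0 < K := by linarith
  -- the exponent of the scale `M ≍ x^e`, `e = max(1 − θ − ν, 0)`
  set e : ℝ := max (1 - θ - ν) 0 with hedef
  have he0 : 0 ≤ e := le_max_right _ _
  have he1 : 1 - θ - ν ≤ e := le_max_left _ _
  have helt : e < 1 - θ := max_lt (by linarith) (by linarith)
  have hec : e < c := max_lt (by linarith) hc
  have hδ : 0 < (c - e) / 2 := by linarith
  filter_upwards [eventually_ge_atTop (4 : ℝ),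
    eventually_mul_rpow_le_rpow 12 helt,
    eventually_mul_rpow_le_rpow 48 (by linarith : e < 1),
    eventually_mul_rpow_le_rpow 96 (by linarith : e + (1 - c) + (c - e) / 2 < 1),
    (isLittleO_log_rpow_atTop hδ).bound one_pos,
    ((tendsto_rpow_atTop (by linarith : 0 < B - 1)).comp
      Real.tendsto_log_atTop).eventually_gt_atTop (8 * K)]
    with x hx4 e1 e2 e3 elog e4 a A hA hcov hII
  rw [Real.rpow_one] at e2 e3
  have hx0 : 0 < x := by linarith
  have hx1 : 1 ≤ x := by linarith
  have hlx : 0 ≤ Real.log x := Real.log_nonneg hx1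
  have hlogle : Real.log x ≤ x ^ ((c - e) / 2) := by
    have := elog
    simp only [one_mul, Real.norm_eq_abs] at this
    rwa [abs_of_nonneg hlx, abs_of_nonneg (Real.rpow_nonneg hx0.le _)] at this
  have e4' : 8 * K < Real.log x ^ (B - 1) := by simpa using e4
  set M : ℕ := ⌊x ^ e⌋₊ + 2 with hMdef
  have hM2 : 2 ≤ M := by omega
  have hM2r : (2 : ℝ) ≤ M := by exact_mod_cast hM2
  have hMe : x ^ e < M := by
    have := Nat.lt_floor_add_one (x ^ e)
    push_cast [hMdef]
    linarith
  have hxe1 : 1 ≤ x ^ e := Real.one_le_rpow hx1 he0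
  have hMle : (M : ℝ) ≤ 3 * x ^ e := by
    have h1 : (⌊x ^ e⌋₊ : ℝ) ≤ x ^ e := Nat.floor_le (Real.rpow_nonneg hx0.le _)
    push_cast [hMdef]
    linarith
  -- window facts: `2M ≤ (x/2)^(1-θ)` and `x^(1-θ-ν) < M`
  have hhalf : x ^ (1 - θ) / 2 ≤ (x / 2) ^ (1 - θ) := by
    rw [Real.div_rpow hx0.le (by norm_num)]
    have : (2 : ℝ) ^ (1 - θ) ≤ 2 := by
      conv_rhs => rw [← Real.rpow_one 2]
      exact Real.rpow_le_rpow_of_exponent_le (by norm_num) (by linarith)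
    have h2pos : (0 : ℝ) < 2 ^ (1 - θ) := by positivity
    rw [div_le_div_iff₀ two_pos h2pos]
    nlinarith [Real.rpow_nonneg hx0.le (1 - θ)]
  have h2M : 2 * (M : ℝ) ≤ (x / 2) ^ (1 - θ) := by linarith
  set S : Finset ℕ := (Ioc M (2 * M)).filter Nat.Prime with hSdef
  have hSprop : ∀ p ∈ S, p.Prime ∧ (M : ℝ) < p ∧ (p : ℝ) ≤ x ∧
      (p : ℝ) * (x / 2) ^ θ ≤ x / 2 ∧ x ≤ (p : ℝ) * x ^ (θ + ν) := by
    intro p hp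
    rw [hSdef, mem_filter, mem_Ioc] at hp
    obtain ⟨⟨hMp, hp2M⟩, hpr⟩ := hp
    have hMp' : (M : ℝ) < p := by exact_mod_cast hMp
    have hp2M' : (p : ℝ) ≤ 2 * M := by exact_mod_cast hp2M
    have hple : (p : ℝ) ≤ (x / 2) ^ (1 - θ) := hp2M'.trans h2M
    refine ⟨hpr, hMp', ?_, ?_, ?_⟩
    · have : (x / 2) ^ (1 - θ) ≤ (x / 2) ^ (1 : ℝ) :=
        Real.rpow_le_rpow_of_exponent_le (by linarith) (by linarith)
      rw [Real.rpow_one] at this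
      linarith
    · have hsplit : (x / 2) ^ (1 - θ) * (x / 2) ^ θ = x / 2 := by
        rw [← Real.rpow_add (by linarith)]
        simp
      calc (p : ℝ) * (x / 2) ^ θ ≤ (x / 2) ^ (1 - θ) * (x / 2) ^ θ :=
            mul_le_mul_of_nonneg_right hple (Real.rpow_nonneg (by linarith) _)
        _ = x / 2 := hsplit
    · have hlow : x ^ (1 - θ - ν) ≤ p := by
        have : x ^ (1 - θ - ν) ≤ x ^ e := Real.rpow_le_rpow_of_exponent_le hx1 he1
        linarith
      have hsplit : x ^ (1 - θ - ν) * x ^ (θ + ν) = x := by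
        rw [← Real.rpow_add hx0]
        simp
      calc x = x ^ (1 - θ - ν) * x ^ (θ + ν) := hsplit.symm
        _ ≤ p * x ^ (θ + ν) := mul_le_mul_of_nonneg_right hlow (Real.rpow_nonneg hx0.le _)
  have hmain :=
    typeII_sparse_le' (by linarith) hx1 (by linarith : (1 : ℝ) < M) S A hSprop hcov hII
  -- lower bounds (identical to the unreflected case with `θ` replaced by `e`)
  have hL : Real.log x / Real.log M ≤ 2 * Real.log x := by
    have hlogM : Real.log 2 ≤ Real.log M := Real.log_le_log two_pos hM2r
    have hl2 := Real.log_two_gt_d9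
    rw [div_le_iff₀ (by linarith)]
    nlinarith
  have hcardS := hK M (by omega)
  have hsum : (S.card : ℝ) * (x / (4 * M) - 1) ≤ ∑ p ∈ S, (x / (2 * p) - 1) := by
    rw [← nsmul_eq_mul, ← sum_const]
    refine sum_le_sum fun p hp => ?_
    have hp2M : (p : ℝ) ≤ 2 * M := by
      have := hp; rw [hSdef, mem_filter, mem_Ioc] at this; exact_mod_cast this.1.2
    have hp0 : (0 : ℝ) < p := by exact_mod_cast (hSprop p hp).1.pos
    have : x / (4 * M) ≤ x / (2 * p) :=
      div_le_div_of_nonneg_left hx0.le (by positivity) (by linarith)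
    linarith
  have hX : (S.card : ℝ) * (A.card * (Real.log x / Real.log M)) ≤
      S.card * (x ^ (1 - c) * (2 * Real.log x)) := by
    apply mul_le_mul_of_nonneg_left _ (Nat.cast_nonneg _)
    exact mul_le_mul hA hL (div_nonneg hlx (Real.log_nonneg (by linarith)))
      (Real.rpow_nonneg hx0.le _)
  have h8M : 8 * (M : ℝ) * (1 + 2 * x ^ (1 - c) * Real.log x) ≤ x := by
    have t1 : 8 * (M : ℝ) ≤ x / 2 := by linarith
    have hnn1 : 0 ≤ x ^ (1 - c) := Real.rpow_nonneg hx0.le _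
    have hprod : x ^ e * x ^ (1 - c) * x ^ ((c - e) / 2) = x ^ (e + (1 - c) + (c - e) / 2) := by
      rw [← Real.rpow_add hx0, ← Real.rpow_add hx0]
    have t2a : (M : ℝ) * x ^ (1 - c) * Real.log x ≤
        3 * x ^ e * x ^ (1 - c) * x ^ ((c - e) / 2) := by
      have := mul_le_mul hMle (mul_le_mul_of_nonneg_left hlogle hnn1) (by positivity)
        (by positivity)
      linarith [this, mul_assoc (M : ℝ) (x ^ (1 - c)) (Real.log x),
        mul_assoc (3 * x ^ e) (x ^ (1 - c)) (x ^ ((c - e) / 2))]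
    rw [← hprod] at e3
    have t2 : 16 * (M : ℝ) * x ^ (1 - c) * Real.log x ≤ x / 2 := by linarith
    have : 8 * (M : ℝ) * (1 + 2 * x ^ (1 - c) * Real.log x) =
        8 * M + 16 * M * x ^ (1 - c) * Real.log x := by ring
    linarith
  have h2Mx : 2 * (M : ℝ) ≤ x := by linarith
  have hlog2M0 : 0 < Real.log (2 * M) := Real.log_pos (by linarith)
  have hlog2M : Real.log (2 * M) ≤ Real.log x := Real.log_le_log (by positivity) h2Mx
  have hlx0 : 0 < Real.log x := by linarith
  have hTlow : x / (8 * K * Real.log x) ≤ (S.card : ℝ) * (x / (8 * M)) := by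
    have hMK : (M : ℝ) / (K * Real.log x) ≤ S.card :=
      le_trans (div_le_div_of_nonneg_left (by positivity) (mul_pos hK0 hlog2M0)
        (mul_le_mul_of_nonneg_left hlog2M hK0.le)) hcardS
    have hMne : (M : ℝ) ≠ 0 := by positivity
    have hlxne : Real.log x ≠ 0 := hlx0.ne'
    have hKne : K ≠ 0 := hK0.ne'
    calc x / (8 * K * Real.log x) = (M : ℝ) / (K * Real.log x) * (x / (8 * M)) := by
          field_simp
      _ ≤ S.card * (x / (8 * M)) := mul_le_mul_of_nonneg_right hMK (by positivity)
  have hmid : (S.card : ℝ) * (x / (8 * M)) ≤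
      S.card * (x / (4 * M) - 1 - x ^ (1 - c) * (2 * Real.log x)) := by
    apply mul_le_mul_of_nonneg_left _ (Nat.cast_nonneg _)
    have hM8 : (0 : ℝ) < 8 * M := by positivity
    have h81 : 1 + 2 * x ^ (1 - c) * Real.log x ≤ x / (8 * M) := by
      rw [le_div_iff₀ hM8]; linarith
    have hMne : (M : ℝ) ≠ 0 := by positivity
    have h84 : x / (4 * M) = 2 * (x / (8 * M)) := by
      field_simp; ring
    linarith
  have hfin := div_log_rpow_lt hK0 (by linarith) e4'
  linarith

end Summit.Parity.BatemanHorn.Theorems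

end
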